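import Summits.ABC.IUTFork.Cor312SlotHull
import Summits.ABC.IUTFork.Cor312ThetaSideReduction
import HarnessLib

/-!
# [IUTchIII] Corollary 3.12 IN READING (P) — local bookkeeping of the SLOT-HULL quantities over any typed setting:
# (P) = (U) where the full hull is the region; `WithTop` forms; `−|log(Θ)|^{(P)}` from local equalities

PROOF-ONLY file (D-0012; no definitions, no `Prop` facts) of the abc-iut cell (R2 S-chain team, seat abc-iut-s2-p7 gen 3, CLAIM «HΘP-K»:
the READ-P binder `hReadP` of abc-iut-C-cert-2's γ certificate `Conditional.abc_of_slotLicence_orNumP_K_szpiroBad`, p458998; C-lead rulings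
C-R35 (3)(γ) / C-R38). TAKES NO SIDE on [IUTchIII] Cor. 3.12 or on the reading (U)/(P) of `−|log(Θ)|`.

S. Mochizuki, *Inter-universal Teichmüller theory III* [Mochizuki2012]: Cor. 3.12 p. 173–174 and its proof Step (x) p. 181 (the log-volume
computed «for each possible image»); *IUT IV* Thm. 1.10 Step (viii) p. 30–31 (the place-by-place sum); T. Dupuy, A. Hilado [DupuyHilado2025]
§4.11–4.12. abc-iut-C-cert-2's `Cor312SlotHull` (p458847, over the FROZEN `Cor312.Setting`, abc-iut-c312-1's shape) forms `thetaSlotImages j v_ℚ` =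
the translates of the (Ind3)-region by the (Ind2)-FAMILIES ONLY, `thetaSlotHull` = the frame's hull of their union, and the reading-(P) twins
`SlotHullDefined` / `thetaSlotLocal` / `ThetaSlotFinite` / `negLogThetaSlot` of the frozen `HullDefined` / `thetaLocal` / `ThetaFinite` /
`negLogTheta`. THIS FILE is generic bookkeeping over ANY setting (the reading-(P) twin of abc-iut-s2-p8's `Cor312ThetaSideExactAssemblyM` §1):

* `thetaSlotLocal_eq_thetaLocal_of_thetaHull_subset` — wherever the full hull `^{n,∘}𝒰_{j,v_ℚ}` is already the (Ind3)-region (e.g. at the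
  primes of good reduction: every possible image of the unit lattice is the unit lattice), the slot union IS the full union and
  `thetaSlotLocal j v_ℚ = thetaLocal j v_ℚ`;
* `slotHullDefined_of_hullDefined`, `thetaSlotLocal_untopD_eq`, `thetaSlotLocal_eq_coe`, `thetaSlotLocal_le_coe_of_untopD_le`,
  `coe_le_thetaSlotLocal_of_le_untopD` — `WithTop` plumbing under `SlotHullDefined`;
* `finsum_thetaSlotLocal_eq`, `thetaSlotFinite_of_thetaSlotLocal_eq`, **`negLogThetaSlot_eq_of_thetaSlotLocal_eq`** — if at every label
  `j ∈ 𝔽_l^⋇` the local slot term equals `b` on a finite set `T′` and vanishes off it, then `ThetaSlotFinite` holds and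
  `negLogThetaSlot = ↑(Σ_{v_ℚ ∈ T′} (1/ℓ⋆)·Σ_i b i v_ℚ)` (abc-iut-w5-d166 `processionNormalized_sum_comm`).

[cite: Mochizuki2012, IUTchIII Cor. 3.12 p. 173–174, proof Step (x) p. 181] [cite: Mochizuki2012, IUTchIV Thm. 1.10 Step (viii) p. 30–31]
[cite: DupuyHilado2025, §4.11–4.12] [claim: Mochizuki2012, status: disputed] for every quoted construction. HONEST FRAMING: identities between
OUR typed objects; reading (P) is a STRONGER-THAN-PRINT reading of Step (x)/(xi-f); nothing here asserts or denies Cor. 3.12 or takes a side on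
any author; typed ≠ proved.
-/

noncomputable section

open Set Function

namespace Summit.ABC.IUTFork.Cor312.Setting



open Thm311 Literature.IUT.LogThetaLattice

variable {T : ThetaIndex} {S : Situation T} (P : Setting S)

/-- Where the full hull `^{n,∘}𝒰_{j,v_ℚ}` is already the (Ind3)-region, the union of the (Ind2)-slot images IS the union of all
possible images (both are squeezed between the region and its hull). [folklore] -/
theorem sUnion_thetaSlotImages_eq_of_thetaHull_subset {j : T.Label} {vQ : T.VQ}
    (h : P.thetaHull j vQ ⊆ P.thetaRegion3 j vQ) :
    ⋃₀ P.thetaSlotImages j vQ = ⋃₀ P.possibleImages j vQ :=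
  (P.sUnion_thetaSlotImages_subset j vQ).antisymm
    ((((P.frame j vQ).subset_hull _).trans h).trans (Set.subset_sUnion_of_mem (P.thetaRegion3_mem_thetaSlotImages j vQ)))

/-- Where the full hull is already the (Ind3)-region, the slot hull IS the full hull. [folklore] -/
theorem thetaSlotHull_eq_thetaHull_of_thetaHull_subset {j : T.Label} {vQ : T.VQ}
    (h : P.thetaHull j vQ ⊆ P.thetaRegion3 j vQ) : P.thetaSlotHull j vQ = P.thetaHull j vQ := by
  unfold thetaSlotHull thetaHull
  rw [P.sUnion_thetaSlotImages_eq_of_thetaHull_subset h]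

/-- Where the full hull is already the (Ind3)-region, `SlotHullDefined ↔ HullDefined`. [folklore] -/
theorem slotHullDefined_iff_of_thetaHull_subset {j : T.Label} {vQ : T.VQ}
    (h : P.thetaHull j vQ ⊆ P.thetaRegion3 j vQ) : P.SlotHullDefined j vQ ↔ P.HullDefined j vQ := by
  unfold SlotHullDefined HullDefined
  rw [P.sUnion_thetaSlotImages_eq_of_thetaHull_subset h]

/-- **Reading (P) = reading (U) locally wherever the full hull is the (Ind3)-region** (e.g. at the primes of good reduction, where
every possible image of the unit lattice is the unit lattice): `thetaSlotLocal j v_ℚ = thetaLocal j v_ℚ`. [folklore] -/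
theorem thetaSlotLocal_eq_thetaLocal_of_thetaHull_subset {j : T.Label} {vQ : T.VQ}
    (h : P.thetaHull j vQ ⊆ P.thetaRegion3 j vQ) : P.thetaSlotLocal j vQ = P.thetaLocal j vQ := by
  unfold thetaSlotLocal thetaLocal
  by_cases hd : P.HullDefined j vQ
  · rw [if_pos hd, if_pos ((P.slotHullDefined_iff_of_thetaHull_subset h).mpr hd),
      P.thetaSlotHull_eq_thetaHull_of_thetaHull_subset h]
  · rw [if_neg hd, if_neg (mt (P.slotHullDefined_iff_of_thetaHull_subset h).mp hd)]

/-- `SlotHullDefined` from `HullDefined` and a hull for the slot union (boundedness is inherited from the larger union).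
[folklore] -/
theorem slotHullDefined_of_hullDefined {j : T.Label} {vQ : T.VQ} (h : P.HullDefined j vQ)
    (hh : (P.frame j vQ).HasHull (⋃₀ P.thetaSlotImages j vQ)) : P.SlotHullDefined j vQ :=
  ⟨P.isBounded_sUnion_thetaSlotImages_of_hullDefined h, hh⟩

/-- Under `SlotHullDefined` the local slot term is the log-volume of the slot hull. [folklore] -/
theorem thetaSlotLocal_untopD_eq {j : T.Label} {vQ : T.VQ} (h : P.SlotHullDefined j vQ) :
    (P.thetaSlotLocal j vQ).untopD 0 = (S.D P.n).logvol j vQ (P.thetaSlotHull j vQ) := by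
  rw [thetaSlotLocal, if_pos h, WithTop.untopD_coe]

/-- Under `SlotHullDefined` the local slot term is a real number. [folklore] -/
theorem thetaSlotLocal_eq_coe {j : T.Label} {vQ : T.VQ} (h : P.SlotHullDefined j vQ) :
    P.thetaSlotLocal j vQ = (((S.D P.n).logvol j vQ (P.thetaSlotHull j vQ) : ℝ) : WithTop ℝ) := by
  rw [thetaSlotLocal, if_pos h]

/-- The `WithTop` form of a real upper bound on the local slot term. [folklore] -/
theorem thetaSlotLocal_le_coe_of_untopD_le {j : T.Label} {vQ : T.VQ} (h : P.SlotHullDefined j vQ) {b : ℝ}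
    (hb : (P.thetaSlotLocal j vQ).untopD 0 ≤ b) : P.thetaSlotLocal j vQ ≤ ((b : ℝ) : WithTop ℝ) := by
  rw [P.thetaSlotLocal_eq_coe h] at hb ⊢
  rw [WithTop.untopD_coe] at hb
  exact WithTop.coe_le_coe.mpr hb

/-- The `WithTop` form of a real lower bound on the local slot term. [folklore] -/
theorem coe_le_thetaSlotLocal_of_le_untopD {j : T.Label} {vQ : T.VQ} (h : P.SlotHullDefined j vQ) {b : ℝ}
    (hb : b ≤ (P.thetaSlotLocal j vQ).untopD 0) : ((b : ℝ) : WithTop ℝ) ≤ P.thetaSlotLocal j vQ := by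
  rw [P.thetaSlotLocal_eq_coe h] at hb ⊢
  rw [WithTop.untopD_coe] at hb
  exact WithTop.coe_le_coe.mpr hb

/-- **The slot-reading global Θ-volume at one label from local equalities**: if the local slot term at label `i+1` equals `b i v_ℚ` on
`T′` and vanishes off `T′`, then `Σ_{v_ℚ} (thetaSlotLocal).untopD 0 = Σ_{v_ℚ ∈ T′} b i v_ℚ` (a finite sum). [folklore] -/
theorem finsum_thetaSlotLocal_eq (Tset : Finset T.VQ) (b : Fin T.lstar → T.VQ → ℝ) (i : Fin T.lstar)
    (hzero : ∀ vQ : T.VQ, vQ ∉ Tset → P.thetaSlotLocal (labelSucc i) vQ = ((0 : ℝ) : WithTop ℝ))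
    (heq : ∀ vQ ∈ Tset, P.thetaSlotLocal (labelSucc i) vQ = ((b i vQ : ℝ) : WithTop ℝ)) :
    ∑ᶠ vQ : T.VQ, (P.thetaSlotLocal (labelSucc i) vQ).untopD 0 = ∑ vQ ∈ Tset, b i vQ := by
  classical
  have hsupp : (Function.support fun vQ : T.VQ => (P.thetaSlotLocal (labelSucc i) vQ).untopD 0) ⊆ (Tset : Set T.VQ) := by
    intro vQ hvQ
    by_contra hv
    apply hvQ
    show (P.thetaSlotLocal (labelSucc i) vQ).untopD 0 = 0
    rw [hzero vQ hv, WithTop.untopD_coe]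
  rw [finsum_eq_sum_of_support_subset _ hsupp]
  exact Finset.sum_congr rfl fun vQ hvQ => by rw [heq vQ hvQ, WithTop.untopD_coe]

/-- `ThetaSlotFinite` from local equalities on a finite set and vanishing off it. [folklore] -/
theorem thetaSlotFinite_of_thetaSlotLocal_eq (Tset : Finset T.VQ) (b : Fin T.lstar → T.VQ → ℝ)
    (hzero : ∀ (i : Fin T.lstar) (vQ : T.VQ), vQ ∉ Tset → P.thetaSlotLocal (labelSucc i) vQ = ((0 : ℝ) : WithTop ℝ))
    (heq : ∀ (i : Fin T.lstar), ∀ vQ ∈ Tset, P.thetaSlotLocal (labelSucc i) vQ = ((b i vQ : ℝ) : WithTop ℝ)) :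
    P.ThetaSlotFinite := by
  classical
  refine ⟨fun i vQ => ?_, fun i => ?_⟩
  · by_cases hv : vQ ∈ Tset
    · rw [heq i vQ hv]; exact WithTop.coe_ne_top
    · rw [hzero i vQ hv]; exact WithTop.coe_ne_top
  · refine (Tset.finite_toSet).subset fun vQ hvQ => ?_
    by_contra hv
    apply hvQ
    show (P.thetaSlotLocal (labelSucc i) vQ).untopD 0 = 0
    rw [hzero i vQ hv, WithTop.untopD_coe]

/-- **`−|log(Θ)|^{(P)} = ↑(Σ_{v_ℚ ∈ T′} (1/ℓ⋆)·Σ_i b i v_ℚ)` from local EQUALITIES** — the slot twin of abc-iut-s2-p8's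
`negLogTheta_eq_of_thetaLocal_eq`: if at every label `j ∈ 𝔽_l^⋇` the local slot term equals `b` on the finite set `T′` and vanishes off it,
then `ThetaSlotFinite` holds and `negLogThetaSlot` IS the procession-normalised place-sum of `b` ([IUTchIV] Thm. 1.10 Step (viii), place-first
form). [cite: Mochizuki2012, IUTchIV Thm. 1.10 Step (viii) p. 30–31] -/
theorem negLogThetaSlot_eq_of_thetaSlotLocal_eq (Tset : Finset T.VQ) (b : Fin T.lstar → T.VQ → ℝ)
    (hzero : ∀ (i : Fin T.lstar) (vQ : T.VQ), vQ ∉ Tset → P.thetaSlotLocal (labelSucc i) vQ = ((0 : ℝ) : WithTop ℝ))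
    (heq : ∀ (i : Fin T.lstar), ∀ vQ ∈ Tset, P.thetaSlotLocal (labelSucc i) vQ = ((b i vQ : ℝ) : WithTop ℝ)) :
    P.negLogThetaSlot = ((∑ vQ ∈ Tset, (1 / (T.lstar : ℝ)) * ∑ i : Fin T.lstar, b i vQ : ℝ) : WithTop ℝ) := by
  classical
  have hfin : P.ThetaSlotFinite := P.thetaSlotFinite_of_thetaSlotLocal_eq Tset b hzero heq
  unfold negLogThetaSlot
  rw [if_pos hfin, ← processionNormalized_sum_comm]
  congr 2
  funext i
  exact P.finsum_thetaSlotLocal_eq Tset b i (hzero i) (heq i)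

end Summit.ABC.IUTFork.Cor312.Setting

end

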